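/-
Copyright (c) 2026 the pub-hodgecm-mathlib formalisation cell (harness21).  Prover seat hodgecm-mathlib-K2E1-p11 (g2), Track B ∕ K2-LIT, h413 =
`stmt-HodgeConjecture-24833`, line `K2_E1_TraceFormulaBeta`, campaigns «EIS-RANK-ONE» ∕ «EIS-R7-BL-SPH-3» (R8-LADDER-2∕3, «MS-2»∕«MS-3») — THE `hid` PAYER of the operator road
(dealer K2E1-plan (g6) ruling (100)(3) 2026-09-04T10:51:12Z: «YOUR FILE BY NAME NOW = the `hid` PAYER `Theorems/K2E1BLHighPartIdentificationU.lean` RANK N»): the identification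
letter `hid` of K2E4-p11's (O2c) `exists_highPartOperator`, at every rank, by the ROUGH-IDENTIFICATION route (no operator-level commutation `δ ∘ cnst = cnst ∘ δ` is needed).
-/
import Summits.HodgeConjecture.HodgeConjecture.Theorems.K2E1TruncatedCuspConstantTermAEU2          -- ★ p859335 (K2-defs1): the lift `⇑f ∘ π`, its fibre average `Ψ₀`: `measurable_fibreAverage`, `fibreAverage_adelicUnipBorel_mul`, `zFun_fibreAverage_toBorelQuotient`, `memLp_zFun_fibreAverage`; brings ★ FILE M, ★ RestrictU2, ★ QuotientMeasureU
import Summits.HodgeConjecture.HodgeConjecture.Theorems.K2E1BLConstantTermProjectionMeasurableU2  -- ★ `setIntegral_zFun_borelConstantTerm_eq'` (hdis' form); brings ★ FILE A `cnstN_toHN_eq_toHN_of_forall_setIntegral_eq`, ★ `integral_zFun_borelConstantTerm_eq_of_unfolding`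
import Summits.HodgeConjecture.HodgeConjecture.Theorems.K2E1BLHighCuspOperatorU                    -- ★ p859427 (K2E4-p11): `ae_weightedTruncMeasure_zero_of_ae`; brings ★ `ae_weightedTruncMeasure_iff`, `ae_lt_borelQuotHeight_weightedTruncMeasure`, `deltaShift_spec`, `coeFn_iota`
import Summits.HodgeConjecture.HodgeConjecture.Theorems.K2E1BLRightConvTonelliU2                   -- ★ (K2E1-p09): `rightConvFun_congr_ae_restrict` (null-set transfer along `(z, y) ↦ z·y`)
import Summits.HodgeConjecture.HodgeConjecture.Theorems.K2E1TruncatedCuspMassBoundU2               -- ★ `quasiMeasurePreserving_toBorelQuotient_of_unfolding` (`π : (G(𝔸), ν_G) → (Z, μZ)`)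
import Summits.HodgeConjecture.HodgeConjecture.Theorems.K2E1BLLiftIntegrabilityU                    -- ★ p859529 (this seat): `borelConstantTerm_rightConv_comm_lift` (rough `hcomm`, Fubini)
import HarnessLib

/-!
# h413 ∕ Track B «K2-LIT» — `K2E1BLHighPartIdentificationU` (RANK `N`): the identification letter `hid` of the high-part operator —
# `R(h)(ιu − cnst ιu)(π g) = R_G(h)ũ(g) − (R_G(h)ũ)_B(g)` for a.e. `π g ∈ Z_T`, `ũ(g) = u[g⁻¹]` the rough lift of `u ∈ 𝓗_k(𝔛)`

Cell `pub/hodgecm-mathlib`, crux H413 = `stmt-HodgeConjecture-24833`, route `HCCMUnconditional`; dealer K2E1-plan (g6) ruling (100)(3).  THEOREMS ONLY (no `def` ∕ `instance` ∕ `notation` ∕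
named-fact hypothesis ∕ `sorry`; default heartbeats); lane `--kind proof --supports stmt-HodgeConjecture-24833 --as helper` (count-neutral; closes no socket).
THE LETTER (K2E4-p11 (g5) (O2c) census 2026-09-04T10:50:44Z, l.11574).  `exists_highPartOperator` builds the transported high-cusp operator `K = M ∘L K_Z : 𝓗_k(𝔛) →L L²(𝔛, μ)` from ★ (O2a)
`K_Z u =ᵐ R(h)(ιu − cnst_k ιu)` on `Z_T` and ★ (O2b) Siegel transport, HYPOTHESIS-FIRST on
`hid : ∀ u, ∀ᵐ z ∂(wtm 0 T μZ), ∀ g, π g = z → R(h)⇑(ιu − cnst ιu) z = (∫ h(y)·u[(g y)⁻¹] dν_G) − (x' ↦ ∫ h(y)·u[(x' y)⁻¹] dν_G)_B(g)`.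
THE MATHEMATICS [BernsteinLapid2019, §4 Claims 4–5 p. 10; MoeglinWaldspurger1995, I.2.6, I.2.13].  Write `Φ₀ := ⇑(ιu) ∘ π`, `Ψ₀ := (Φ₀)_B` (fibre average over `N(F)∖N(𝔸)`), `ũ(g) := u[g⁻¹]`.
(1) ROUGH IDENTIFICATION (§1): for EVERY class `f ∈ 𝓗_k(Z_c)`, `cnst_k f = [zFun ((⇑f ∘ π)_B)]` — the conditional expectation onto the `N(𝔸)`-invariant σ-algebra IS the fibre average, with no
continuity: ★ FILE A's set-integral characterisation of `condExpL2`, ★ FILE M's Borel descent (`zFun Ψ₀` is `mN`-measurable for Borel `Ψ₀`), ★ K2-defs1's `L²`-bound for `zFun Ψ₀`, and the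
set-integral identity `∫_s zFun Ψ₀ = ∫_s zFun Φ₀` on `mN`-sets (★ `setIntegral_zFun_borelConstantTerm_eq'` with the disintegration ★ `integral_zFun_borelConstantTerm_eq_of_unfolding`).
(2) LINEARITY BY THE `δ`-TRICK (§2): `R(h)⇑(ιu − cnst ιu) =ᵐ ⇑δ(ιu − cnst ιu) = ⇑διu − ⇑δ(cnst ιu) =ᵐ R(h)⇑ιu − R(h)⇑(cnst ιu)` on `Z_{a₀}` (★ `deltaShift_spec`; no integrability bookkeeping).
(3) FIRST TERM (§2): `⇑ιu =ᵐ u ∘ p` on `Z_a` (★ `coeFn_iota`), so `R(h)⇑ιu =ᵐ R(h)(u ∘ p)` on `Z_{a₀}` (★ null-set transfer `rightConvFun_congr_ae_restrict`, heights `κa ≤ a₀`), and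
`R(h)(u ∘ p)(π g) = ∫ h(y)·u[(g y)⁻¹] dν_G` IDENTICALLY.  (4) SECOND TERM (§2): `R(h)⇑(cnst ιu) =ᵐ R(h)(zFun Ψ₀)` likewise, `R(h)(zFun Ψ₀)(π g) = ∫ h(y)·Ψ₀(g y) dν_G` identically; `Ψ₀(g y) = ũ_B(g y)`
for `ν_G`-a.e. `y ∈ supp h` (the fibre integrands `Φ₀(n g y)`, `ũ(n g y)` agree for a.e. `(y, n)`: `π` is quasi-measure-preserving `(G(𝔸), ν_G) → (Z, μZ)` — ★ `…_of_unfolding` —, so is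
`(y, n) ↦ n g y` into `ν_G`, Fubini); and `∫ h(y)·ũ_B(g y) dν_G = (R_G(h)ũ)_B(g)` is the rough commutation ★ `borelConstantTerm_rightConv_comm_lift` (this seat's LIFT BRICK p859529).
(5) `wtm_{k,a₀}`-a.e. ⟹ `wtm_{0,T}`-a.e. for `a₀ ≤ T` (★ `ae_weightedTruncMeasure_zero_of_ae`).
* §1 **`cnstN_eq_toHN_fibreAverage`** (every class; every rank) and its a.e. reading `coeFn_cnstN_ae_eq_zFun_fibreAverage`.
* §2 **`hid_of_unfolding`** — THE HEAD, in K2E4-p11's bytes, under the structural unfolding letters (`νN`, `hconj`, `h𝓕`, `h𝓕₀`, `h𝓕top`, `h𝓕c`, `hβ`, `hμZ`) of ★ `hK1_cm_two∕three` and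
  the test-function data (`h ∈ C_c`, height distortion `κ` on `tsupport h`, `κa ≤ a₀ ≤ T`, `hs : ShiftBound k a a₀ νG μZ h`) of ★ `exists_convData_cm_two∕three` — all ★ at the CM pairs.
HONEST LABEL.  Count-neutral helper; proves no printed statement; HC_CM is proved only modulo the 7 printed citations (2 remaining named inputs: hLiu418 = `stmt-HodgeConjecture-24832`, h413 =
`stmt-HodgeConjecture-24833`) until rung 0 closes.

## References
* [BernsteinLapid2019] J. Bernstein, E. Lapid, *On the meromorphic continuation of Eisenstein series*, J. AMS 37 (2024) (arXiv:1911.02342), §4 Claims 4–5 (p. 10).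
* [MoeglinWaldspurger1995] C. Mœglin, J.-L. Waldspurger, *Spectral decomposition and Eisenstein series* (1995), I.2.6, I.2.13, I.2.18.
* [Folland1995] G. B. Folland, *A Course in Abstract Harmonic Analysis* (1995), Thm. 2.49 (Weil's formula).
-/

set_option autoImplicit false
-- the mandated namespace repeats `HodgeConjecture.HodgeConjecture`, as in every `Theorems/*.lean` of this sub-problem
set_option linter.dupNamespace false

noncomputable section

open MeasureTheory MeasureTheory.Measure Set NumberField IsDedekindDomain Filter Topology
open scoped NNReal ENNReal
open Literature.MeasureTheory.Group Literature.NumberTheory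
open Literature.NumberTheory.Automorphic Literature.NumberTheory.Automorphic.UnitaryGroup AdelicGroupData
open Summit.HodgeConjecture.HodgeConjecture.Cruxes.H413.K2E1BLBorelSpacesU2Defs
open Summit.HodgeConjecture.HodgeConjecture.Cruxes.H413.K2E1BLBorelOperatorsU2Defs
open Summit.HodgeConjecture.HodgeConjecture.Cruxes.H413.K2E1BLConstantTermProjectionU2 (cnstN_toHN_eq_toHN_of_forall_setIntegral_eq)
open Summit.HodgeConjecture.HodgeConjecture.Cruxes.H413.K2E1BLConstantTermProjectionRestrictU2 (coe_comp_toBorelQuotient_mul memLp_zFun_coe_comp_toBorelQuotient toHN_coe_comp_toBorelQuotient)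
open Summit.HodgeConjecture.HodgeConjecture.Cruxes.H413.K2E1BLConstantTermProjectionMeasurableU2 (setIntegral_zFun_borelConstantTerm_eq')
open Summit.HodgeConjecture.HodgeConjecture.Cruxes.H413.K2E1BLFibreAverageInvarianceU (integral_zFun_borelConstantTerm_eq_of_unfolding)
open Summit.HodgeConjecture.HodgeConjecture.Cruxes.H413.K2E1BLInvariantSigmaDescentU (aestronglyMeasurable_invariantSigma_zFun_of_measurable)
open Summit.HodgeConjecture.HodgeConjecture.Cruxes.H413.K2E1TruncatedCuspConstantTermAEU2 (measurable_coe_comp_toBorelQuotient sFinite_of_isHaarMeasure_adelicUnipotent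
  measurable_fibreAverage fibreAverage_adelicUnipBorel_mul zFun_fibreAverage_toBorelQuotient memLp_zFun_fibreAverage)
open Summit.HodgeConjecture.HodgeConjecture.Cruxes.H413.K2E1BLQuotientMeasureU (measurePreserving_rightShift_of_unfolding)
open Summit.HodgeConjecture.HodgeConjecture.Cruxes.H413.K2E1BLShiftBoundU2 (ae_weightedTruncMeasure_iff)
open Summit.HodgeConjecture.HodgeConjecture.Cruxes.H413.K2E1TruncatedCuspCompactU2 (ae_lt_borelQuotHeight_weightedTruncMeasure measurableSet_lt_borelQuotHeight)
open Summit.HodgeConjecture.HodgeConjecture.Cruxes.H413.K2E1BLHighCuspOperatorU (ae_weightedTruncMeasure_zero_of_ae)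
open Summit.HodgeConjecture.HodgeConjecture.Cruxes.H413.K2E1BLRightConvTonelliU2 (rightConvFun_congr_ae_restrict)
open Summit.HodgeConjecture.HodgeConjecture.Cruxes.H413.K2E1TruncatedCuspMassBoundU2 (quasiMeasurePreserving_toBorelQuotient_of_unfolding)
open Summit.HodgeConjecture.HodgeConjecture.Cruxes.H413.K2E1BLLiftIntegrabilityU (borelConstantTerm_rightConv_comm_lift)
open Summit.HodgeConjecture.HodgeConjecture.Cruxes.H413.K2E1IntertwiningAdjoint Summit.HodgeConjecture.HodgeConjecture.Cruxes.H413.K2E1IntertwinedSectionInvariance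

namespace Summit.HodgeConjecture.HodgeConjecture.Cruxes.H413.K2E1BLHighPartIdentificationU

variable {F E : Type} [Field F] [NumberField F] [Field E] [NumberField E] [Algebra F E] {c : E ≃ₐ[F] E} {N : ℕ} [NeZero N]
variable [MeasurableSpace (quasiSplit F E c N).Adelic] [BorelSpace (quasiSplit F E c N).Adelic]

variable (νG : Measure (quasiSplit F E c N).Adelic) [νG.IsHaarMeasure]
  (νN : Measure ↥(adelicUnipotent F E c N)) [νN.IsHaarMeasure] [νN.IsInvInvariant] [νN.IsMulRightInvariant]
  (hconj : ∀ b₀ (hb₀ : b₀ ∈ borelU (c : E →+* E) ((StdForm.antidiagonal N).over E)),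
    νN.map (fun v : ↥(adelicUnipotent F E c N) => (⟨((quasiSplit F E c N).toAdelic b₀)⁻¹ * (v : (quasiSplit F E c N).Adelic) * (quasiSplit F E c N).toAdelic b₀,
      conj_mem_adelicUnipotent ((K2E1PseudoEisensteinConstantTermU.toAdelic_mem_borelAdelic_iff b₀).2 hb₀) v.2⟩ : ↥(adelicUnipotent F E c N))) = νN)
  {𝓕 : Set ↥(adelicUnipotent F E c N)} (h𝓕 : IsFundamentalDomain ↥(rationalUnipotent F E c N) 𝓕 νN) (h𝓕₀ : νN 𝓕 ≠ 0) (h𝓕top : νN 𝓕 ≠ ∞)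
  {β : (quasiSplit F E c N).Adelic → ℝ≥0∞} (hβ : IsCoveringWeight ↥((arithmeticBorel F E c N).map (quasiSplit F E c N).arithmeticSubgroup.subtype) β)
  {μZ : Measure (borelQuotient F E c N)}
  (hμZ : ∀ f : borelQuotient F E c N → ℝ≥0∞, Measurable f → ∫⁻ z, f z ∂μZ = ∫⁻ g, β g * f (toBorelQuotient F E c N g) ∂νG)

/-! ## §1 The constant-term projection of a ROUGH class is its fibre average -/

include hconj h𝓕 h𝓕₀ h𝓕top hβ hμZ in
/-- **ROUGH IDENTIFICATION: `cnst_k f = [zFun ((⇑f ∘ π)_B)]` FOR EVERY CLASS `f ∈ 𝓗_k(Z_c)`** (no continuity).  `f = toHN (⇑f ∘ π)` (★ RestrictU2); the fibre average `Ψ₀ = (⇑f ∘ π)_B` is Borel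
and left-`N(𝔸)B(F)`-invariant, so `zFun Ψ₀` is `mN`-measurable (★ FILE M, Borel descent) and in `L²(μw)` (★ K2-defs1); its integrals over `mN`-sets agree with those of `zFun (⇑f ∘ π)`
(★ `setIntegral_zFun_borelConstantTerm_eq'`, the disintegration letter paid by ★ `integral_zFun_borelConstantTerm_eq_of_unfolding`); conclude by ★ FILE A's set-integral characterisation
of the conditional expectation `cnst_k`. [cite: BernsteinLapid2019, §4 Claim 4 (p. 10)] [cite: MoeglinWaldspurger1995, I.2.6] -/
theorem cnstN_eq_toHN_fibreAverage (k : ℕ) (c₁ : ℝ≥0) [IsFiniteMeasure (weightedTruncMeasure F E c N k c₁ μZ)] (f : HN F E c N k c₁ μZ) :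
    cnstN F E c N k c₁ μZ f = toHN F E c N k c₁ μZ (borelConstantTerm νN 𝓕 ((f : borelQuotient F E c N → ℂ) ∘ toBorelQuotient F E c N))
      (memLp_zFun_fibreAverage νG νN hconj h𝓕 h𝓕₀ h𝓕top hβ hμZ k c₁ f) := by
  haveI := sFinite_of_isHaarMeasure_adelicUnipotent νN
  have hφ2 := memLp_zFun_coe_comp_toBorelQuotient k c₁ μZ f
  have hψ2 := memLp_zFun_fibreAverage νG νN hconj h𝓕 h𝓕₀ h𝓕top hβ hμZ k c₁ f
  conv_lhs => rw [← toHN_coe_comp_toBorelQuotient k c₁ μZ f hφ2]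
  refine cnstN_toHN_eq_toHN_of_forall_setIntegral_eq k c₁ μZ hφ2 hψ2
    (aestronglyMeasurable_invariantSigma_zFun_of_measurable (measurable_fibreAverage k c₁ μZ f νN 𝓕) (fibreAverage_adelicUnipBorel_mul k c₁ μZ f νN 𝓕 h𝓕) _)
    fun s hs _ => ?_
  exact setIntegral_zFun_borelConstantTerm_eq' νN 𝓕 k c₁ μZ
    (fun _ hΦm hΦB hint hint' => integral_zFun_borelConstantTerm_eq_of_unfolding νG νN hconj h𝓕 h𝓕₀ h𝓕top hβ hμZ k c₁ hΦm hΦB hint hint')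
    (measurable_coe_comp_toBorelQuotient k c₁ μZ f) (coe_comp_toBorelQuotient_mul _) (hφ2.integrable one_le_two) (hψ2.integrable one_le_two) hs

include hconj h𝓕 h𝓕₀ h𝓕top hβ hμZ in
/-- The a.e. reading: **`⇑(cnst_k f) = zFun ((⇑f ∘ π)_B)` `μw`-a.e.** for every class `f`. [cite: BernsteinLapid2019, §4 Claim 4 (p. 10)] [cite: MoeglinWaldspurger1995, I.2.6] -/
theorem coeFn_cnstN_ae_eq_zFun_fibreAverage (k : ℕ) (c₁ : ℝ≥0) [IsFiniteMeasure (weightedTruncMeasure F E c N k c₁ μZ)] (f : HN F E c N k c₁ μZ) :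
    ((cnstN F E c N k c₁ μZ f : HN F E c N k c₁ μZ) : borelQuotient F E c N → ℂ) =ᵐ[weightedTruncMeasure F E c N k c₁ μZ]
      zFun F E c N (borelConstantTerm νN 𝓕 ((f : borelQuotient F E c N → ℂ) ∘ toBorelQuotient F E c N)) := by
  rw [cnstN_eq_toHN_fibreAverage νG νN hconj h𝓕 h𝓕₀ h𝓕top hβ hμZ k c₁ f]
  exact coeFn_toHN F E c N k c₁ μZ _ _

/-! ## §2 The letter `hid` -/

variable (μ : Measure (quasiSplit F E c N).automorphicQuotient) [(quasiSplit F E c N).IsAutomorphicMeasure μ]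

include hconj h𝓕 h𝓕₀ h𝓕top hβ hμZ in
/-- **THE LETTER `hid` OF (O2c) `exists_highPartOperator`, RANK `N`.**  Structural letters: `μ` automorphic; `ν_G` Haar, inversion- and right-invariant, s-finite; `ν_N` Haar on `N(𝔸)` with the
product-formula conjugation invariance `hconj`; `𝓕` a fundamental domain of `N(F)` of finite non-zero measure and compact closure; the covering weight `β` and the unfolded s-finite `μZ`
(`hμZ`).  Test-function data: `h ∈ C_c(G(𝔸))`, a height distortion `κ > 0` on `tsupport h` with `κ·a ≤ a₀ ≤ T`, the shift letter `hs : ShiftBound k a a₀ νG μZ h`; the pull-back letter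
`hb : IotaBound k a μ μZ`; `μw_{k,a}` finite.  THEN for every `u ∈ 𝓗_k(𝔛)`, for `wtm_{0,T}`-a.e. `z` and every `g` with `π g = z`:
`R(h)⇑(ιu − cnst_k ιu)(z) = (∫ h(y)·u[(g y)⁻¹] dν_G(y)) − (x' ↦ ∫ h(y)·u[(x' y)⁻¹] dν_G(y))_B(g)` (module docstring (2)–(5)).
[cite: BernsteinLapid2019, §4 Claims 4–5 (p. 10)] [cite: MoeglinWaldspurger1995, I.2.6, I.2.13] -/
theorem hid_of_unfolding [νG.IsInvInvariant] [νG.IsMulRightInvariant] [SFinite νG] [SFinite μZ] (h𝓕c : IsCompact (closure 𝓕))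
    {k : ℕ} {a a₀ T : ℝ≥0} [IsFiniteMeasure (weightedTruncMeasure F E c N k a μZ)] (hb : IotaBound F E c N k a μ μZ)
    {h : (quasiSplit F E c N).Adelic → ℂ} (hh : Continuous h) (hhs : HasCompactSupport h)
    {κ : ℝ≥0} (hκ : 0 < κ) (hc : κ * a ≤ a₀)
    (hΩ : ∀ z : borelQuotient F E c N, ∀ y ∈ tsupport h, borelQuotHeight F E c N z ≤ κ * borelQuotHeight F E c N (rightShift F E c N y z))
    (hs : ShiftBound F E c N k a a₀ νG μZ h) (haT : a₀ ≤ T) (u : HX F E c N k μ) :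
    ∀ᵐ z ∂(weightedTruncMeasure F E c N 0 T μZ), ∀ g : (quasiSplit F E c N).Adelic, toBorelQuotient F E c N g = z →
      rightConvFun F E c N νG h ((iota hb u - cnstN F E c N k a μZ (iota hb u) : HN F E c N k a μZ) : borelQuotient F E c N → ℂ) z =
        (∫ y, h y * (u : (quasiSplit F E c N).automorphicQuotient → ℂ) ((quasiSplit F E c N).toAutomorphicQuotient (g * y)⁻¹) ∂νG) -
          borelConstantTerm νN 𝓕 (fun x' => ∫ y, h y * (u : (quasiSplit F E c N).automorphicQuotient → ℂ) ((quasiSplit F E c N).toAutomorphicQuotient (x' * y)⁻¹) ∂νG) g := by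
  haveI : SecondCountableTopology (quasiSplit F E c N).Adelic := secondCountableTopology_quasiSplitAdelic
  haveI := sFinite_of_isHaarMeasure_adelicUnipotent νN
  -- notation-free abbreviations
  set ιu : HN F E c N k a μZ := iota hb u with hιu
  set Pιu : HN F E c N k a μZ := cnstN F E c N k a μZ ιu with hPιu
  set Φ₀ : (quasiSplit F E c N).Adelic → ℂ := (ιu : borelQuotient F E c N → ℂ) ∘ toBorelQuotient F E c N with hΦ₀
  set Ψ₀ : (quasiSplit F E c N).Adelic → ℂ := borelConstantTerm νN 𝓕 Φ₀ with hΨ₀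
  -- structural facts
  have hright : ∀ y, MeasurePreserving (rightShift F E c N y) μZ μZ := measurePreserving_rightShift_of_unfolding νG hβ hμZ
  have hπ : QuasiMeasurePreserving (toBorelQuotient F E c N) νG μZ := quasiMeasurePreserving_toBorelQuotient_of_unfolding νG hβ hμZ
  have hΩm : MeasurableSet (tsupport h) := (isClosed_tsupport h).measurableSet
  have hsupp : ∀ y, y ∉ tsupport h → h y = 0 := fun y hy => image_eq_zero_of_notMem_tsupport hy
  have hSa : MeasurableSet {z : borelQuotient F E c N | a < borelQuotHeight F E c N z} := measurableSet_lt_borelQuotHeight a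
  -- heights: above `a₀` every `tsupport h`-translate is above `a`
  have hup : ∀ x : (quasiSplit F E c N).Adelic, a₀ < borelHeight x → ∀ y ∈ tsupport h, a < borelHeight (x * y) := by
    intro x hx y hy
    have h1 : borelQuotHeight F E c N (toBorelQuotient F E c N x) ≤ κ * borelQuotHeight F E c N (rightShift F E c N y (toBorelQuotient F E c N x)) := hΩ _ y hy
    rw [rightShift_toBorelQuotient, borelQuotHeight_toBorelQuotient, borelQuotHeight_toBorelQuotient] at h1
    exact lt_of_mul_lt_mul_left ((hc.trans_lt hx).trans_le h1) hκ.le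
  -- (3) the first term: `⇑ιu = u ∘ p` a.e. on `Z_a`, transferred along `z ↦ z·y`
  have h12 : ((ιu : HN F E c N k a μZ) : borelQuotient F E c N → ℂ) =ᵐ[μZ.restrict {z | a < borelQuotHeight F E c N z}] iotaFun F E c N k μ u :=
    (ae_weightedTruncMeasure_iff μZ k a).1 (coeFn_iota hb u)
  have h4 : rightConvFun F E c N νG h ((ιu : HN F E c N k a μZ) : borelQuotient F E c N → ℂ) =ᵐ[weightedTruncMeasure F E c N k a₀ μZ]
      rightConvFun F E c N νG h (iotaFun F E c N k μ u) :=
    (ae_weightedTruncMeasure_iff μZ k a₀).2 (rightConvFun_congr_ae_restrict νG μZ hright hΩm hκ hc hΩ hsupp h12)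
  have hpt4 : ∀ g : (quasiSplit F E c N).Adelic, rightConvFun F E c N νG h (iotaFun F E c N k μ u) (toBorelQuotient F E c N g) =
      ∫ y, h y * (u : (quasiSplit F E c N).automorphicQuotient → ℂ) ((quasiSplit F E c N).toAutomorphicQuotient (g * y)⁻¹) ∂νG := fun g => by
    simp only [rightConvFun, iotaFun, rightShift_toBorelQuotient, pZX_toBorelQuotient]
  -- (4) the second term: `⇑(cnst ιu) = zFun Ψ₀` a.e. on `Z_a` (§1), transferred likewise
  have h12' : ((Pιu : HN F E c N k a μZ) : borelQuotient F E c N → ℂ) =ᵐ[μZ.restrict {z | a < borelQuotHeight F E c N z}] zFun F E c N Ψ₀ :=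
    (ae_weightedTruncMeasure_iff μZ k a).1 (coeFn_cnstN_ae_eq_zFun_fibreAverage νG νN hconj h𝓕 h𝓕₀ h𝓕top hβ hμZ k a ιu)
  have h5 : rightConvFun F E c N νG h ((Pιu : HN F E c N k a μZ) : borelQuotient F E c N → ℂ) =ᵐ[weightedTruncMeasure F E c N k a₀ μZ]
      rightConvFun F E c N νG h (zFun F E c N Ψ₀) :=
    (ae_weightedTruncMeasure_iff μZ k a₀).2 (rightConvFun_congr_ae_restrict νG μZ hright hΩm hκ hc hΩ hsupp h12')
  have hpt5 : ∀ g : (quasiSplit F E c N).Adelic, rightConvFun F E c N νG h (zFun F E c N Ψ₀) (toBorelQuotient F E c N g) = ∫ y, h y * Ψ₀ (g * y) ∂νG := fun g => by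
    simp only [rightConvFun, rightShift_toBorelQuotient, hΨ₀, hΦ₀, zFun_fibreAverage_toBorelQuotient k a μZ ιu νN 𝓕 h𝓕]
  -- (4′) `Ψ₀(g y) = ũ_B(g y)` for a.e. `y ∈ tsupport h`, for every `g` above `a₀` (Fubini along the quasi-measure-preserving `(y, n) ↦ n g y`)
  have hΨ : ∀ g : (quasiSplit F E c N).Adelic, a₀ < borelHeight g →
      (fun y => h y * Ψ₀ (g * y)) =ᵐ[νG] fun y => h y * borelConstantTerm νN 𝓕
        (fun x' => (u : (quasiSplit F E c N).automorphicQuotient → ℂ) ((quasiSplit F E c N).toAutomorphicQuotient x'⁻¹)) (g * y) := by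
    intro g hg
    have hmeas : Measurable fun p : (quasiSplit F E c N).Adelic × ↥(adelicUnipotent F E c N) => (p.2 : (quasiSplit F E c N).Adelic) * g * p.1 :=
      (((continuous_subtype_val.comp continuous_snd).mul continuous_const).mul continuous_fst).measurable
    have hm : QuasiMeasurePreserving (fun p : (quasiSplit F E c N).Adelic × ↥(adelicUnipotent F E c N) => (p.2 : (quasiSplit F E c N).Adelic) * g * p.1)
        (νG.prod (νN.restrict 𝓕)) νG :=
      QuasiMeasurePreserving.prod_of_left hmeas (Eventually.of_forall fun n =>
        (measurePreserving_mul_left νG ((n : (quasiSplit F E c N).Adelic) * g)).quasiMeasurePreserving)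
    have h1' : ∀ᵐ z ∂μZ, z ∈ {z : borelQuotient F E c N | a < borelQuotHeight F E c N z} →
        ((ιu : HN F E c N k a μZ) : borelQuotient F E c N → ℂ) z = iotaFun F E c N k μ u z := (ae_restrict_iff' hSa).1 h12
    have hyn := Measure.ae_ae_of_ae_prod ((hπ.comp hm).ae h1')
    filter_upwards [hyn] with y hy
    by_cases hyΩ : y ∈ tsupport h
    · congr 1
      rw [hΨ₀, borelConstantTerm_def, borelConstantTerm_def]
      congr 1
      refine integral_congr_ae ?_
      filter_upwards [hy] with n hn
      have hmem : toBorelQuotient F E c N ((n : (quasiSplit F E c N).Adelic) * g * y) ∈ {z : borelQuotient F E c N | a < borelQuotHeight F E c N z} := by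
        show a < borelQuotHeight F E c N (toBorelQuotient F E c N ((n : (quasiSplit F E c N).Adelic) * g * y))
        rw [borelQuotHeight_toBorelQuotient, mul_assoc, borelHeight_unipotent_mul n.2]
        exact hup g hg y hyΩ
      have hn' := hn hmem
      simp only [hΦ₀, Function.comp_apply, iotaFun, pZX_toBorelQuotient] at hn' ⊢
      rw [← mul_assoc]
      exact hn'
    · rw [hsupp y hyΩ, zero_mul, zero_mul]
  -- (2) linearity by the `δ`-trick, and assembly on `Z_{a₀}`
  have hsub : ((deltaShift hs (ιu - Pιu) : HN F E c N k a₀ μZ) : borelQuotient F E c N → ℂ) =ᵐ[weightedTruncMeasure F E c N k a₀ μZ]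
      ((deltaShift hs ιu : HN F E c N k a₀ μZ) : borelQuotient F E c N → ℂ) - ((deltaShift hs Pιu : HN F E c N k a₀ μZ) : borelQuotient F E c N → ℂ) := by
    rw [map_sub]; exact Lp.coeFn_sub _ _
  have hall : ∀ᵐ z ∂(weightedTruncMeasure F E c N k a₀ μZ), ∀ g : (quasiSplit F E c N).Adelic, toBorelQuotient F E c N g = z →
      rightConvFun F E c N νG h ((ιu - Pιu : HN F E c N k a μZ) : borelQuotient F E c N → ℂ) z =
        (∫ y, h y * (u : (quasiSplit F E c N).automorphicQuotient → ℂ) ((quasiSplit F E c N).toAutomorphicQuotient (g * y)⁻¹) ∂νG) -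
          borelConstantTerm νN 𝓕 (fun x' => ∫ y, h y * (u : (quasiSplit F E c N).automorphicQuotient → ℂ) ((quasiSplit F E c N).toAutomorphicQuotient (x' * y)⁻¹) ∂νG) g := by
    filter_upwards [deltaShift_spec hs (ιu - Pιu), hsub, deltaShift_spec hs ιu, deltaShift_spec hs Pιu, h4, h5,
      ae_lt_borelQuotHeight_weightedTruncMeasure k a₀ μZ] with z hz0 hzs hz1 hz2 hz4 hz5 hza g hg
    subst hg
    rw [← hz0, hzs, Pi.sub_apply, hz1, hz2, hz4, hz5, hpt4 g, hpt5 g]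
    congr 1
    rw [borelQuotHeight_toBorelQuotient] at hza
    rw [borelConstantTerm_rightConv_comm_lift μ νG k (Lp.memLp u) hh hhs νN h𝓕c g]
    exact integral_congr_ae (hΨ g hza)
  -- (5) down to `Z_T`
  exact ae_weightedTruncMeasure_zero_of_ae haT hall

end Summit.HodgeConjecture.HodgeConjecture.Cruxes.H413.K2E1BLHighPartIdentificationU

end
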